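import Summits.HodgeConjecture.HodgeConjecture.Theorems.EightfoldBlochSeedsChernCharacterOnBettiAnalytificationCharacter
import Literature.AlgebraicGeometry.HodgeTheory.SectionFramesOfTrivialisations
import HarnessLib

/-!
# K1 (analytification bridge), `ch_congr`: isomorphic `𝒪_X`-modules have isomorphic analytifications,
# hence the same Betti Chern classes / character

Route `EightfoldBlochSeeds` / item `stmt-HodgeConjecture-19780` (`ChernCharacterOnBetti`), helper
(`--supports`). HONEST FRAMING: nothing here proves 19780 / 18880 / 18882 / 18883 / H2 / HC_AV / HC;
no definition, no named fact.

WHAT. The field `ch_congr (e : E ≅ F) : ch X E i = ch X F i` of `ChernCharacterBetti`. A topological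
comparison datum `(E, α)` for `F` (steps 2–4) is TRANSPORTED along an isomorphism of modules
`φ : F ≅ F'` to the datum `(E, α ∘ φ⁻¹)` for `F'` (`comparison_transport_iso`: additivity,
`𝒪_X`-linearity, restriction, continuity and frames ↦ bases are preserved; frames themselves are
transported, `HodgeTheory.IsSectionFrame.map_iso`). With K1b (`exists_iso_of_comparison`, two data of
one module are isomorphic) this gives:

* `exists_iso_of_comparison_of_iso` — data `(E, α)` for `F` and `(E', α')` for `F' ≅ F` are
  isomorphic complex vector bundles;
* `chernClassZ_eq_of_comparison_of_iso`, `chernClassIn_eq_of_comparison_of_iso`,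
  `topologicalChernCharacter_eq_of_comparison_of_iso` — hence have the same Chern classes (any
  coefficients) and Chern character on a smooth projective `X`.

[cite: SerreGAGA1956, §3 n°9 Déf. 2 and Prop. 10] [cite: HusemollerFibreBundles1994, Ch. 17 §3 (C₁)]
[cite: Fulton1998, §15.1]
-/

noncomputable section

-- single-problem summit (Problem = Summit): the mandated namespace repeats `HodgeConjecture`.
set_option linter.dupNamespace false

open CategoryTheory AlgebraicGeometry Bundle Topology
open Literature.AlgebraicGeometry.Motives Literature.AlgebraicGeometry.HodgeTheory
open Literature.AlgebraicTopology.SingularHomology Literature.AlgebraicTopology.CharacteristicClasses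

namespace Summit.HodgeConjecture.HodgeConjecture.Theorems

variable {n : ℕ} {X : SchemeOver ℂ} {F F' : X.left.Modules} {r : ℕ}

/-- **Transport of a comparison datum along an isomorphism of modules**: if `(E, α)` is a
topological comparison datum for `F` and `φ : F ≅ F'`, then `(E, α ∘ φ⁻¹)` is one for `F'`.
[cite: SerreGAGA1956, §3 n°9 Déf. 2] -/
theorem comparison_transport_iso (φ : F ≅ F') (E : ComplexVectorBundle.{0, 0} (ComplexPoints X))
    (α : ∀ U : X.left.Opens, Γ(F, U) → ∀ P : ComplexPoints X, E.E P)
    (hadd : ∀ (U : X.left.Opens) (σ τ : Γ(F, U)) (P : ComplexPoints X), α U (σ + τ) P = α U σ P + α U τ P)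
    (hsmul : ∀ (U : X.left.Opens) (f : Γ(X.left, U)) (σ : Γ(F, U)) (P : ComplexPoints X) (h : P.pt ∈ U),
      α U (f • σ) P = P.eval U h f • α U σ P)
    (hres : ∀ (U W : X.left.Opens) (hWU : W ≤ U) (σ : Γ(F, U)) (P : ComplexPoints X), P.pt ∈ W →
      α W (F.presheaf.map (homOfLE hWU).op σ) P = α U σ P)
    (hcont : ∀ (U : X.left.Opens) (σ : Γ(F, U)),
      ContinuousOn (fun P ↦ (⟨P, α U σ P⟩ : TotalSpace E.F E.E)) {P | P.pt ∈ U})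
    (hframe : ∀ (U : X.left.Opens) (t : Fin r → Γ(F, U)), IsSectionFrame F U t →
      ∀ P : ComplexPoints X, P.pt ∈ U → LinearIndependent ℂ (fun j ↦ α U (t j) P) ∧
        ⊤ ≤ Submodule.span ℂ (Set.range fun j ↦ α U (t j) P)) :
    (∀ (U : X.left.Opens) (σ τ : Γ(F', U)) (P : ComplexPoints X),
        α U (φ.inv.app U (σ + τ)) P = α U (φ.inv.app U σ) P + α U (φ.inv.app U τ) P) ∧
    (∀ (U : X.left.Opens) (f : Γ(X.left, U)) (σ : Γ(F', U)) (P : ComplexPoints X) (h : P.pt ∈ U),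
        α U (φ.inv.app U (f • σ)) P = P.eval U h f • α U (φ.inv.app U σ) P) ∧
    (∀ (U W : X.left.Opens) (hWU : W ≤ U) (σ : Γ(F', U)) (P : ComplexPoints X), P.pt ∈ W →
        α W (φ.inv.app W (F'.presheaf.map (homOfLE hWU).op σ)) P = α U (φ.inv.app U σ) P) ∧
    (∀ (U : X.left.Opens) (σ : Γ(F', U)),
        ContinuousOn (fun P ↦ (⟨P, α U (φ.inv.app U σ) P⟩ : TotalSpace E.F E.E)) {P | P.pt ∈ U}) ∧
    (∀ (U : X.left.Opens) (t : Fin r → Γ(F', U)), IsSectionFrame F' U t →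
        ∀ P : ComplexPoints X, P.pt ∈ U → LinearIndependent ℂ (fun j ↦ α U (φ.inv.app U (t j)) P) ∧
          ⊤ ≤ Submodule.span ℂ (Set.range fun j ↦ α U (φ.inv.app U (t j)) P)) := by
  refine ⟨fun U σ τ P ↦ by rw [map_add, hadd], fun U f σ P h ↦ by rw [Scheme.Modules.Hom.app_smul, hsmul],
    fun U W hWU σ P hP ↦ by rw [app_presheaf_map, hres U W hWU _ P hP], fun U σ ↦ hcont U _,
    fun U t ht P hP ↦ hframe U (fun j ↦ φ.inv.app U (t j)) (IsSectionFrame.map_iso φ.symm ht) P hP⟩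

/-- **Data for isomorphic modules are isomorphic bundles**: for `φ : F ≅ F'`, a datum `(E, α)` for `F`
and a datum `(E', α')` for `F'` (frames of size `r`), there is `e : E ≅ E'` with
`e(α_U(σ)(P)) = α'_U(φ_U σ)(P)`. [cite: SerreGAGA1956, §3 n°9 Déf. 2 and Prop. 10] -/
theorem exists_iso_of_comparison_of_iso (φ : F ≅ F')
    (hF : ∀ x : X.left, ∃ (U : X.left.Opens) (s : Fin r → Γ(F, U)), x ∈ U ∧ IsSectionFrame F U s)
    (E E' : ComplexVectorBundle.{0, 0} (ComplexPoints X))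
    (α : ∀ U : X.left.Opens, Γ(F, U) → ∀ P : ComplexPoints X, E.E P)
    (α' : ∀ U : X.left.Opens, Γ(F', U) → ∀ P : ComplexPoints X, E'.E P)
    (hadd : ∀ (U : X.left.Opens) (σ τ : Γ(F, U)) (P : ComplexPoints X), α U (σ + τ) P = α U σ P + α U τ P)
    (hsmul : ∀ (U : X.left.Opens) (f : Γ(X.left, U)) (σ : Γ(F, U)) (P : ComplexPoints X) (h : P.pt ∈ U),
      α U (f • σ) P = P.eval U h f • α U σ P)
    (hres : ∀ (U W : X.left.Opens) (hWU : W ≤ U) (σ : Γ(F, U)) (P : ComplexPoints X), P.pt ∈ W →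
      α W (F.presheaf.map (homOfLE hWU).op σ) P = α U σ P)
    (hcont : ∀ (U : X.left.Opens) (σ : Γ(F, U)),
      ContinuousOn (fun P ↦ (⟨P, α U σ P⟩ : TotalSpace E.F E.E)) {P | P.pt ∈ U})
    (hframe : ∀ (U : X.left.Opens) (t : Fin r → Γ(F, U)), IsSectionFrame F U t →
      ∀ P : ComplexPoints X, P.pt ∈ U → LinearIndependent ℂ (fun j ↦ α U (t j) P) ∧
        ⊤ ≤ Submodule.span ℂ (Set.range fun j ↦ α U (t j) P))
    (hadd' : ∀ (U : X.left.Opens) (σ τ : Γ(F', U)) (P : ComplexPoints X), α' U (σ + τ) P = α' U σ P + α' U τ P)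
    (hsmul' : ∀ (U : X.left.Opens) (f : Γ(X.left, U)) (σ : Γ(F', U)) (P : ComplexPoints X) (h : P.pt ∈ U),
      α' U (f • σ) P = P.eval U h f • α' U σ P)
    (hres' : ∀ (U W : X.left.Opens) (hWU : W ≤ U) (σ : Γ(F', U)) (P : ComplexPoints X), P.pt ∈ W →
      α' W (F'.presheaf.map (homOfLE hWU).op σ) P = α' U σ P)
    (hcont' : ∀ (U : X.left.Opens) (σ : Γ(F', U)),
      ContinuousOn (fun P ↦ (⟨P, α' U σ P⟩ : TotalSpace E'.F E'.E)) {P | P.pt ∈ U})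
    (hframe' : ∀ (U : X.left.Opens) (t : Fin r → Γ(F', U)), IsSectionFrame F' U t →
      ∀ P : ComplexPoints X, P.pt ∈ U → LinearIndependent ℂ (fun j ↦ α' U (t j) P) ∧
        ⊤ ≤ Submodule.span ℂ (Set.range fun j ↦ α' U (t j) P)) :
    ∃ e : E.Iso E', ∀ (U : X.left.Opens) (σ : Γ(F, U)) (P : ComplexPoints X), P.pt ∈ U →
      e.equiv P (α U σ P) = α' U (φ.hom.app U σ) P := by
  obtain ⟨hadd₁, hsmul₁, hres₁, hcont₁, hframe₁⟩ := comparison_transport_iso φ E α hadd hsmul hres hcont hframe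
  obtain ⟨e, he⟩ := exists_iso_of_comparison (exists_isSectionFrame_of_iso φ hF) E E'
    (fun U σ P ↦ α U (φ.inv.app U σ) P) α' hadd₁ hsmul₁ hres₁ hcont₁ hframe₁ hadd' hsmul' hres' hcont' hframe'
  refine ⟨e, fun U σ P hP ↦ ?_⟩
  have h := he U (φ.hom.app U σ) P hP
  have hinv : φ.inv.app U (φ.hom.app U σ) = σ := by
    change (φ.hom.app U ≫ φ.inv.app U) σ = σ
    rw [← Scheme.Modules.Hom.comp_app, φ.hom_inv_id, Scheme.Modules.Hom.id_app]
    rfl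
  simp only [hinv] at h
  exact h

variable (hX : IsSmoothProjective n X) (φ : F ≅ F')
    (hF : ∀ x : X.left, ∃ (U : X.left.Opens) (s : Fin r → Γ(F, U)), x ∈ U ∧ IsSectionFrame F U s)
    (E E' : ComplexVectorBundle.{0, 0} (ComplexPoints X))
    (α : ∀ U : X.left.Opens, Γ(F, U) → ∀ P : ComplexPoints X, E.E P)
    (α' : ∀ U : X.left.Opens, Γ(F', U) → ∀ P : ComplexPoints X, E'.E P)
    (hadd : ∀ (U : X.left.Opens) (σ τ : Γ(F, U)) (P : ComplexPoints X), α U (σ + τ) P = α U σ P + α U τ P)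
    (hsmul : ∀ (U : X.left.Opens) (f : Γ(X.left, U)) (σ : Γ(F, U)) (P : ComplexPoints X) (h : P.pt ∈ U),
      α U (f • σ) P = P.eval U h f • α U σ P)
    (hres : ∀ (U W : X.left.Opens) (hWU : W ≤ U) (σ : Γ(F, U)) (P : ComplexPoints X), P.pt ∈ W →
      α W (F.presheaf.map (homOfLE hWU).op σ) P = α U σ P)
    (hcont : ∀ (U : X.left.Opens) (σ : Γ(F, U)),
      ContinuousOn (fun P ↦ (⟨P, α U σ P⟩ : TotalSpace E.F E.E)) {P | P.pt ∈ U})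
    (hframe : ∀ (U : X.left.Opens) (t : Fin r → Γ(F, U)), IsSectionFrame F U t →
      ∀ P : ComplexPoints X, P.pt ∈ U → LinearIndependent ℂ (fun j ↦ α U (t j) P) ∧
        ⊤ ≤ Submodule.span ℂ (Set.range fun j ↦ α U (t j) P))
    (hadd' : ∀ (U : X.left.Opens) (σ τ : Γ(F', U)) (P : ComplexPoints X), α' U (σ + τ) P = α' U σ P + α' U τ P)
    (hsmul' : ∀ (U : X.left.Opens) (f : Γ(X.left, U)) (σ : Γ(F', U)) (P : ComplexPoints X) (h : P.pt ∈ U),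
      α' U (f • σ) P = P.eval U h f • α' U σ P)
    (hres' : ∀ (U W : X.left.Opens) (hWU : W ≤ U) (σ : Γ(F', U)) (P : ComplexPoints X), P.pt ∈ W →
      α' W (F'.presheaf.map (homOfLE hWU).op σ) P = α' U σ P)
    (hcont' : ∀ (U : X.left.Opens) (σ : Γ(F', U)),
      ContinuousOn (fun P ↦ (⟨P, α' U σ P⟩ : TotalSpace E'.F E'.E)) {P | P.pt ∈ U})
    (hframe' : ∀ (U : X.left.Opens) (t : Fin r → Γ(F', U)), IsSectionFrame F' U t →
      ∀ P : ComplexPoints X, P.pt ∈ U → LinearIndependent ℂ (fun j ↦ α' U (t j) P) ∧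
        ⊤ ≤ Submodule.span ℂ (Set.range fun j ↦ α' U (t j) P))
include hX φ hF hadd hsmul hres hcont hframe hadd' hsmul' hres' hcont' hframe'

/-- **Isomorphic modules have the same integral Betti Chern classes** (computed from any data).
[cite: HusemollerFibreBundles1994, Ch. 17 §3 (C₁)] [cite: SerreGAGA1956, §3 n°9 Prop. 10] -/
theorem chernClassZ_eq_of_comparison_of_iso (i : ℕ) : chernClassZ E i = chernClassZ E' i := by
  haveI := ComplexPoints.t2Space_of_isSmoothProjective hX
  haveI := paracompactSpace_complexPoints_of_isSmoothProjective hX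
  obtain ⟨e, -⟩ := exists_iso_of_comparison_of_iso φ hF E E' α α' hadd hsmul hres hcont hframe
    hadd' hsmul' hres' hcont' hframe'
  exact theChernClassTheory.chernClass_congr e i

/-- The same with coefficients in any commutative ring `R`. [cite: HusemollerFibreBundles1994, Ch. 17 §3 (C₁) and Ch. 20 §4] -/
theorem chernClassIn_eq_of_comparison_of_iso (R : Type) [CommRing R] (i : ℕ) :
    theChernClassTheory.chernClassIn R E i = theChernClassTheory.chernClassIn R E' i := by
  haveI := ComplexPoints.t2Space_of_isSmoothProjective hX
  haveI := paracompactSpace_complexPoints_of_isSmoothProjective hX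
  obtain ⟨e, -⟩ := exists_iso_of_comparison_of_iso φ hF E E' α α' hadd hsmul hres hcont hframe
    hadd' hsmul' hres' hcont' hframe'
  exact theChernClassTheory.chernClassIn_congr R e i

/-- **`ch_congr`: isomorphic modules have the same Betti Chern character** (computed from any data).
[cite: Fulton1998, §15.1] [cite: SerreGAGA1956, §3 n°9 Prop. 10] -/
theorem topologicalChernCharacter_eq_of_comparison_of_iso (k : ℕ) :
    theChernClassTheory.topologicalChernCharacter ℂ E k = theChernClassTheory.topologicalChernCharacter ℂ E' k := by
  haveI := ComplexPoints.t2Space_of_isSmoothProjective hX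
  haveI := paracompactSpace_complexPoints_of_isSmoothProjective hX
  rcases isEmpty_or_nonempty (ComplexPoints X) with hB | hB
  · exact (ModuleCat.eq_zero_of_isZero_obj (isZero_singularCohomology_of_isEmpty' ℂ (ComplexPoints X) (2 * k)) _).trans
      (ModuleCat.eq_zero_of_isZero_obj (isZero_singularCohomology_of_isEmpty' ℂ (ComplexPoints X) (2 * k)) _).symm
  · obtain ⟨e, -⟩ := exists_iso_of_comparison_of_iso φ hF E E' α α' hadd hsmul hres hcont hframe
      hadd' hsmul' hres' hcont' hframe'
    exact theChernClassTheory.topologicalChernCharacter_congr ℂ e (ComplexVectorBundle.Iso.rank_eq e) k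

end Summit.HodgeConjecture.HodgeConjecture.Theorems

end
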